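import Literature.Computability.Complexity.TVFieldBricks
import HarnessLib

/-!
# `FP` bricks for Trevisan–Vadhan's oracle machine, II: reading the blocks of a point

Literature / complexity — derandomization (Case 2 of IW98 in TV07 form), second machine layer
(sequel of `TVFieldBricks.lean`). A point `x ∈ K^{N n}` travels as the string `ptBits n x` of `N n`
blocks of `blk n = M + 1` bits (`TVFunction.lean`); the machine, uniform in `n`, reads block `v` by
unary index arithmetic — drop `v · (M+1)` symbols, keep `M + 1` — with the block length `M + 1` read off
the carried modulus `f` (`|f| = M + 2`). Records here are `⟨P, ⟨1ᵛ, f⟩⟩`: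

* `QBFUniv.drop_take_ptBits` — block `v` of `ptBits n x` is `bits (Mof n) (x v)` (`HashBricks.blk`);
* `TVBrick.blkLenOf` (`1^{M+1}`, i.e. `f` without its first symbol), `TVBrick.blockAt`
  (`(P.drop (v(M+1))).take (M+1)`, via the unary product `HashBricks.umulFn`), with `_mem_FP`, `_apply`,
  and **`blockAt_ptBits`**: on `⟨ptBits n x ++ tail, ⟨1ᵛ, modStr (Mof n)⟩⟩` the value is `bits (Mof n) (x v)`;
* the unary index bricks `TVBrick.idxY`, `idxZ`, `idxX`, `idxS` on `⟨1ⁿ, ⟨1ʲ, 1ᵏ⟩⟩` with values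
  `1^{k + nj}`, `1^{n² + k + nj}`, `1^{2n² + k}`, `1^{2n² + n + k}` — the explicit layout `QBFUniv.lay`
  (`lay_y_val`, `lay_z_val`, `lay_x_val`, `lay_s_val`).

Everything is proved; definitions are `FP` string functions (no named facts).

## References

* [TrevisanVadhan2007] L. Trevisan, S. Vadhan, Comput. Complexity 16 (2007), Thm. 4.3 (proof: the
  layout of `(x, j)`), Lemma 4.1 (i).
* [AroraBarakCC2009] S. Arora, B. Barak, CUP 2009, §1.3 (unary counters, composition).
-/

noncomputable section

namespace Literature.Computability.Complexity

open _root_.Computability Brick Plumb GF2Str HardLangM Literature.InformationTheory.Coding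

/-! ### Blocks of the point bits -/

namespace QBFUniv

/-- **Block `v` of the point bits is `bits (x v)`.** [cite: TrevisanVadhan2007, Thm. 4.3 (proof)] -/
theorem drop_take_ptBits (n : ℕ) (x : Fin (N n) → K n) (v : Fin (N n)) (tail : List Bool) :
    ((ptBits n x ++ tail).drop (v.val * blk n)).take (blk n) = bits (Mof n) (x v) := by
  have hb : blk n = Mof n + 1 := rfl
  have hlen : v.val * blk n + blk n ≤ (ptBits n x).length := by
    rw [length_ptBits, ptLen, ← Nat.succ_mul]; exact Nat.mul_le_mul_right _ v.isLt
  apply List.ext_getElem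
  · rw [List.length_take, List.length_drop, List.length_append, length_bits, Nat.min_eq_left (by omega)]
  intro i h1 h2
  rw [length_bits] at h2
  rw [List.getElem_take, List.getElem_drop, List.getElem_append_left (by omega)]
  have key := getD_ptBits n x v ⟨i, by rw [hb]; omega⟩
  rw [List.getD_eq_getElem _ _ (by simp only; omega)] at key
  simp only [bits, List.getElem_ofFn]
  exact key

end QBFUniv

namespace TVBrick

/-! ### The block reader -/

/-- The point field of `⟨P, ⟨1ᵛ, f⟩⟩`. [folklore] -/
def ptOf : List Bool → List Bool := fstF
/-- The index field of `⟨P, ⟨1ᵛ, f⟩⟩`. [folklore] -/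
def ixOf : List Bool → List Bool := fstF ∘ sndF
/-- The modulus field of `⟨P, ⟨1ᵛ, f⟩⟩`. [folklore] -/
def mdOf : List Bool → List Bool := sndF ∘ sndF

/-- **The block length `1^{M+1}`** (in length): the modulus without its first symbol. [folklore] -/
def blkLenOf : List Bool → List Bool := dropFn ∘ fanoutFn (fun _ => [true]) mdOf

/-- `blkLenOf ∈ FP`. [folklore] -/
theorem blkLenOf_mem_FP : blkLenOf ∈ FP :=
  comp_mem_FP dropFn_mem_FP (fanoutFn_mem_FP (const_mem_FP _) (comp_mem_FP sndF_mem_FP sndF_mem_FP))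

/-- Length of `blkLenOf` on a record with modulus `modStr M`: `M + 1`. [folklore] -/
theorem length_blkLenOf (M : ℕ) (P u : List Bool) : (blkLenOf (boolPair P (boolPair u (modStr M)))).length = M + 1 := by
  simp only [blkLenOf, mdOf, Function.comp_apply, fanoutFn_apply, sndF_boolPair, dropFn_boolPair, List.length_drop,
    (modStr_top M).1, List.length_singleton]
  omega

/-- **The block reader**: `(P.drop (|1ᵛ| · (M+1))).take (M+1)`. [cite: TrevisanVadhan2007, Thm. 4.3 (proof)] -/
def blockAt : List Bool → List Bool :=
  takeFn ∘ fanoutFn blkLenOf (dropFn ∘ fanoutFn (HashBricks.umulFn ∘ fanoutFn ixOf blkLenOf) ptOf)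

/-- `blockAt ∈ FP`. [folklore] -/
theorem blockAt_mem_FP : blockAt ∈ FP :=
  comp_mem_FP takeFn_mem_FP (fanoutFn_mem_FP blkLenOf_mem_FP (comp_mem_FP dropFn_mem_FP
    (fanoutFn_mem_FP (comp_mem_FP HashBricks.umulFn_mem_FP (fanoutFn_mem_FP (comp_mem_FP fstF_mem_FP sndF_mem_FP) blkLenOf_mem_FP))
      fstF_mem_FP)))

/-- Value of the block reader. [folklore] -/
theorem blockAt_apply (M : ℕ) (P : List Bool) (v : ℕ) :
    blockAt (boolPair P (boolPair (ones v) (modStr M))) = HashBricks.blk P (M + 1) v := by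
  have hl := length_blkLenOf M P (ones v)
  simp only [blockAt, ptOf, ixOf, Function.comp_apply, fanoutFn_apply, fstF_boolPair, sndF_boolPair, HashBricks.umulFn_apply,
    ones, List.length_replicate, hl, dropFn_boolPair, takeFn_boolPair, HashBricks.blk]

/-- **The block reader on point bits**: block `v` is `bits (x v)`. [cite: TrevisanVadhan2007, Thm. 4.3 (proof)] -/
theorem blockAt_ptBits (n : ℕ) (x : Fin (QBFUniv.N n) → QBFUniv.K n) (v : Fin (QBFUniv.N n)) (tail : List Bool) :
    blockAt (boolPair (QBFUniv.ptBits n x ++ tail) (boolPair (ones v.val) (modStr (QBFUniv.Mof n)))) =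
      bits (QBFUniv.Mof n) (x v) := by
  rw [blockAt_apply, HashBricks.blk]
  exact QBFUniv.drop_take_ptBits n x v tail

/-! ### Unary index arithmetic for the explicit layout -/

/-- `1ⁿ` of `⟨1ⁿ, ⟨1ʲ, 1ᵏ⟩⟩`. [folklore] -/
def unN : List Bool → List Bool := fstF
/-- `1ʲ` of `⟨1ⁿ, ⟨1ʲ, 1ᵏ⟩⟩`. [folklore] -/
def unJ : List Bool → List Bool := fstF ∘ sndF
/-- `1ᵏ` of `⟨1ⁿ, ⟨1ʲ, 1ᵏ⟩⟩`. [folklore] -/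
def unK : List Bool → List Bool := sndF ∘ sndF

/-- **Index of `y_{jk}`**: `1^{k + n j}`. [folklore] -/
def idxY : List Bool → List Bool := appF ∘ fanoutFn unK (HashBricks.umulFn ∘ fanoutFn unN unJ)
/-- **Index of `z_{jk}`**: `1^{n² + (k + n j)}`. [folklore] -/
def idxZ : List Bool → List Bool := appF ∘ fanoutFn (HashBricks.umulFn ∘ fanoutFn unN unN) idxY
/-- **Index of `x_k`**: `1^{2n² + k}`. [folklore] -/
def idxX : List Bool → List Bool :=
  appF ∘ fanoutFn (appF ∘ fanoutFn (HashBricks.umulFn ∘ fanoutFn unN unN) (HashBricks.umulFn ∘ fanoutFn unN unN)) unK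
/-- **Index of `s_k`**: `1^{2n² + n + k}`. [folklore] -/
def idxS : List Bool → List Bool := appF ∘ fanoutFn idxX unN  -- `(2n² + k) + n`, same length as `2n² + n + k`

/-- The index bricks are in `FP`. [folklore] -/
theorem idx_mem_FP : idxY ∈ FP ∧ idxZ ∈ FP ∧ idxX ∈ FP ∧ idxS ∈ FP := by
  have hN : unN ∈ FP := fstF_mem_FP
  have hJ : unJ ∈ FP := comp_mem_FP fstF_mem_FP sndF_mem_FP
  have hK : unK ∈ FP := comp_mem_FP sndF_mem_FP sndF_mem_FP
  have hm : ∀ {A B : List Bool → List Bool}, A ∈ FP → B ∈ FP → HashBricks.umulFn ∘ fanoutFn A B ∈ FP := fun hA hB =>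
    comp_mem_FP HashBricks.umulFn_mem_FP (fanoutFn_mem_FP hA hB)
  have ha : ∀ {A B : List Bool → List Bool}, A ∈ FP → B ∈ FP → appF ∘ fanoutFn A B ∈ FP := fun hA hB =>
    comp_mem_FP appF_mem_FP (fanoutFn_mem_FP hA hB)
  have hY : idxY ∈ FP := ha hK (hm hN hJ)
  have hX : idxX ∈ FP := ha (ha (hm hN hN) (hm hN hN)) hK
  exact ⟨hY, ha (hm hN hN) hY, hX, ha hX hN⟩

/-- **Values of the index bricks** (as lengths; the content is all-`1`). [folklore] -/
theorem idx_apply (n j k : ℕ) :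
    idxY (boolPair (ones n) (boolPair (ones j) (ones k))) = ones (k + n * j) ∧
    idxZ (boolPair (ones n) (boolPair (ones j) (ones k))) = ones (n * n + (k + n * j)) ∧
    idxX (boolPair (ones n) (boolPair (ones j) (ones k))) = ones (2 * (n * n) + k) ∧
    idxS (boolPair (ones n) (boolPair (ones j) (ones k))) = ones (2 * (n * n) + n + k) := by
  refine ⟨?_, ?_, ?_, ?_⟩ <;>
    simp only [idxY, idxZ, idxX, idxS, unN, unJ, unK, Function.comp_apply, fanoutFn_apply, fstF_boolPair, sndF_boolPair,
      HashBricks.umulFn_apply, ones, List.length_replicate, appF_boolPair, List.replicate_append_replicate] <;>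
    (congr 1; ring)

end TVBrick

end Literature.Computability.Complexity

end
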